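import Literature.Computability.MetaComplexity.ResLinWidthLifting
import HarnessLib

/-!
# The inner-product gadget is 1-stifling; width lifting for the `IP`-lift

The tree's second canonical lift is the inner-product lift `ipLift ℓ φ = gadgetLift (2ℓ) (ipGadget ℓ) φ`
(`GadgetLift.lean`; `IP_ℓ(u) = ⊕_{j<ℓ} (u_{2j} ∧ u_{2j+1})`), the gadget of Itsykson–Podolskii–Shekhovtsov
(CCC 2026, Thm 1.1: Tseitin ∘ IP with `b = (4+η) log n` bits) and of the classical lifting theorems.
For `ℓ ≥ 2` the gadget `IP_ℓ` is 1-STIFLING [Chattopadhyay–Mande–Sanyal–Sherif 2023 (stifling);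
Alekseev–Itsykson 2025 §2.6 defines k-stifling and names only `Maj_{2k+1}` — the `IP` instance is
proved here]: to force the output `b` whatever the bit at position `i`, set the partner of `i` to `0`
(killing the pair of `i`) and one other pair to `(b, b)`, everything else to `0`. Hence the
width-lifting theorem (`ResLinWidthLifting.lean`, Alekseev–Itsykson 2025 Thm 3.1) applies to `ipLift`:

* `isStifling_ipGadget : 2 ≤ ℓ → IsStifling (ipGadget ℓ)`;
* `lt_resLinWidth_ipLift_of_forall_lt_resWidth` — resolution width `> w` for `φ` ⇒ Res(⊕) rank `> w`
  for every refutation of `ipLift ℓ φ` (`ℓ ≥ 2`).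

(`IP_1 = AND₂` is not stifling, and indeed lifting by `AND₂`/`⊕₂` does not lift width to rank.)

## References

* Y. Alekseev, D. Itsykson, STOC 2025 (= ECCC TR24-128), §2.6, Thm 3.1 [AlekseevItsykson2025].
* E. Kushilevitz, N. Nisan, *Communication Complexity* (1996), Example 1.26 (inner product)
  [KushilevitzNisan1996].
-/

namespace Literature.Computability.MetaComplexity

open _root_.Computability Complexity Finset

/-- **`IP_ℓ` is 1-stifling for `ℓ ≥ 2`**: for every position `i` and bit `b`, the block assignment
"partner pair of `i` ↦ 0, one other pair ↦ (b, b), all other pairs ↦ 0" forces `IP_ℓ = b`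
whatever the value at `i`. [Chattopadhyay–Mande–Sanyal–Sherif 2023 (stifling gadgets); the notion
`IsStifling` = Alekseev–Itsykson 2025 §2.6 with k = 1; the `IP` instance is proved here, not quoted]
[cite: ChattopadhyayMandeSanyalSherif2023, §1 (stifling)] -/
theorem isStifling_ipGadget {ℓ : ℕ} (hℓ : 2 ≤ ℓ) : IsStifling (ipGadget ℓ) := by
  intro i b
  -- another pair `j₁`, different from the pair `i / 2` of `i`
  obtain ⟨j₁, hj₁ℓ, hj₁i⟩ : ∃ j₁ : ℕ, j₁ < ℓ ∧ j₁ ≠ (i : ℕ) / 2 := by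
    by_cases h : (i : ℕ) / 2 = 0
    · exact ⟨1, by omega, by omega⟩
    · exact ⟨0, by omega, fun h' => h h'.symm⟩
  refine ⟨fun w => if (w : ℕ) / 2 = j₁ then b else false, fun v hv => ?_⟩
  -- the value of `v` at a position `p ≠ i` is the prescribed one
  have hoff : ∀ (p : ℕ) (hp : p < 2 * ℓ), p ≠ (i : ℕ) →
      v ⟨p, hp⟩ = (if p / 2 = j₁ then b else false) := by
    intro p hp hpi
    have hne : (⟨p, hp⟩ : Fin (2 * ℓ)) ≠ i := fun heq => hpi (congrArg Fin.val heq)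
    rw [hv _ hne]
  -- the conjunction of pair `j` is `b ∧ [j = j₁]`
  have hkey : ∀ j : Fin ℓ,
      (v ⟨2 * (j : ℕ), by have := j.isLt; omega⟩ &&
        v ⟨2 * (j : ℕ) + 1, by have := j.isLt; omega⟩) = (b && decide ((j : ℕ) = j₁)) := by
    intro j
    have hjℓ := j.isLt
    by_cases hji : (j : ℕ) = (i : ℕ) / 2
    · -- the pair of `i`: the partner of `i` carries `0`
      have hjne : (j : ℕ) ≠ j₁ := fun h => hj₁i (h.symm.trans hji)
      rcases Nat.mod_two_eq_zero_or_one (i : ℕ) with h0 | h1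
      · -- `i = 2j`: the partner is `2j + 1`
        have hp : 2 * (j : ℕ) + 1 ≠ (i : ℕ) := by omega
        rw [hoff (2 * (j : ℕ) + 1) (by omega) hp]
        have hdiv : (2 * (j : ℕ) + 1) / 2 = (j : ℕ) := by omega
        rw [hdiv]
        simp [hjne]
      · -- `i = 2j + 1`: the partner is `2j`
        have hp : 2 * (j : ℕ) ≠ (i : ℕ) := by omega
        rw [hoff (2 * (j : ℕ)) (by omega) hp]
        have hdiv : (2 * (j : ℕ)) / 2 = (j : ℕ) := by omega
        rw [hdiv]
        simp [hjne]
    · -- any other pair: both positions are prescribed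
      have hp0 : 2 * (j : ℕ) ≠ (i : ℕ) := by omega
      have hp1 : 2 * (j : ℕ) + 1 ≠ (i : ℕ) := by omega
      rw [hoff (2 * (j : ℕ)) (by omega) hp0, hoff (2 * (j : ℕ) + 1) (by omega) hp1]
      have hdiv0 : (2 * (j : ℕ)) / 2 = (j : ℕ) := by omega
      have hdiv1 : (2 * (j : ℕ) + 1) / 2 = (j : ℕ) := by omega
      rw [hdiv0, hdiv1]
      by_cases hj : (j : ℕ) = j₁ <;> cases b <;> simp [hj]
  -- the set of true pairs is `{j₁}` if `b`, and `∅` otherwise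
  have hset : (Finset.univ.filter fun j : Fin ℓ =>
      v ⟨2 * (j : ℕ), by have := j.isLt; omega⟩ &&
        v ⟨2 * (j : ℕ) + 1, by have := j.isLt; omega⟩) =
      if b = true then {⟨j₁, hj₁ℓ⟩} else ∅ := by
    ext j
    simp only [Finset.mem_filter, Finset.mem_univ, true_and, hkey j]
    cases b
    · simp
    · simp [Fin.ext_iff]
  unfold ipGadget
  rw [hset]
  cases b <;> simp

/-- **Width lifting for the `IP`-lift** [Alekseev–Itsykson 2025, Thm 3.1, with the 1-stifling gadget
`IP_ℓ`, `ℓ ≥ 2`]: if every resolution refutation of `φ` has width `> w`, then every Res(⊕) refutation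
(semantic weakening) of `ipLift ℓ φ` has a line of rank `> w`. [cite: AlekseevItsykson2025, Theorem 3.1] -/
theorem lt_resLinWidth_ipLift_of_forall_lt_resWidth {ℓ : ℕ} (hℓ : 2 ≤ ℓ) {φ : CNF ℕ} {w : ℕ}
    (hφ : ∀ π : List (ResLine ℕ), IsResRefutation φ π → w < resWidth π)
    {π : List ResLinLine} (hπ : IsResLinRefutation (ipLift ℓ φ) π) : w < resLinWidth π :=
  lt_resLinWidth_gadgetLift_of_forall_lt_resWidth (by omega) (isStifling_ipGadget hℓ) hφ hπ

/-- Width lifting for the `MAJ₃`-lift [Alekseev–Itsykson 2025, Thm 3.1 with `g = Maj₃` ("e.g.,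
`Maj₃`")]: if every resolution refutation of `φ` has width `> w`, then every Res(⊕) refutation of
`gadgetLift 3 maj3Gadget φ` has a line of rank `> w`. [cite: AlekseevItsykson2025, Theorem 1.1] -/
theorem lt_resLinWidth_maj3Lift_of_forall_lt_resWidth {φ : CNF ℕ} {w : ℕ}
    (hφ : ∀ π : List (ResLine ℕ), IsResRefutation φ π → w < resWidth π)
    {π : List ResLinLine} (hπ : IsResLinRefutation (gadgetLift 3 maj3Gadget φ) π) :
    w < resLinWidth π :=
  lt_resLinWidth_gadgetLift_of_forall_lt_resWidth (by norm_num) isStifling_maj3Gadget hφ hπ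

end Literature.Computability.MetaComplexity
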